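/- Copyright: the b2b-balaban cell (near-miss cell 7), T⁴-continuum fan-out; row NE7b ROUND-2 swarm, seat
t4-ne7b-formalise-leaf-03 (row S12-W «END ∕ headline re-plug over the memory-agnostic carriers» = the row owner's
INTERFACE REQUEST NE7b IR-41-5, `CLAIMS.log` l.27257; custodian lineage leaf-03 of the Mult-END modules; work list
`HOME/b2b-balaban-t4-ne7b-formalise-leaf-03/g21/S12W-WORKLIST-leaf03-g21.md`, site W5).  Released under the licence of
the surrounding project. -/
import Summits.QuantumFields.BalabanUV.T4Continuum.Support.HistoryAssemblyRealiseRunMultW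
import Summits.QuantumFields.BalabanUV.T4Continuum.Support.HistoryRealiseWeakCells
import Summits.QuantumFields.BalabanUV.T4Continuum.Support.HistoryRealiseCellsRunMult

/-!
# The per-run multiplicity-socket END from the MEMORY-AGNOSTIC domain carrier `RealisedDomainsRW` (S12-W, W5)

Summits-side support leaf of the T⁴-continuum cell (rung (B)+1 on a FINITE torus only; NOT infinite volume, NOT the
mass gap, NOT the Clay statement; NOT a proof of the spine estimate NE7b, which is the cell's OWN estimate, NOT PRINTED
and NOT PROVED).

WHY.  `HistoryRealiseCellsRunMult.hybridNE7_of_realisedDomainsRun_printedMult` (this lineage) reads the class-R binder `realised` as leaf-08's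
`RealisedDomainsR F.L (runProfile F.L R) …`, whose field `real := Realises … ∧ PendingAt … K` carries the row owner's two
located MODEL findings (F-ne7bp1g40-1: pendency one index stronger than print; #3 = R-OWNER-41-1: condition (ii)'s
memory FROZEN at the last event vs print's CURRENT `R_j` — B16 = [Balaban1989LargeFieldII] pp. 383–387, B15 =
[Balaban1989LargeFieldI] pp. 177, 198, manuscripts UNDER AUDIT, locators only, nothing of them asserted).  Repair route
R-41-a (the END must not depend on the readiness CONVENTION; append-only twin chain): THIS FILE is the by-name twin over
`HistoryRealiseWeakCells.RealisedDomainsRW` (IR-41-4 file 3, p250828) with the suppliers `HistoryAssemblyRealiseRunMultW.hybridNE7_of_realisedRunW_printedMult` (S12-W W4) and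
`HistoryRealiseWeakCells.realisedReadingRW_of_domainsRunW`; conclusion VERBATIM.  The landed END stays and is the special
case through `RealisedDomainsR.toW`.

WHAT.  **`hybridNE7_of_realisedDomainsRunW_printedMult`**.  [folklore] composition by name; no definition, no `[cite:]` tag, nothing printed
asserted, zero `sorry`.

HONEST.  DISPLAYED, NOT DISCHARGED: the reading H3^NE7b as `RealisedDomainsRW` (`real`, `track`, `disjoint`, `inBox` — the
owner's M4 is the road that discharges them, NOT this file), (B) at fixed volume, the BetaPertH-flow box bounds + tuning
+ IR smallness, NE7c's `ShellWeightBound`, NE7's `ReindexedBudget` with four summable rates, the printed price sentences,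
the `Regeneration` numerator readings and the slot multiplicity `hmult` (its W-form instance is W3
`HistoryAssemblyMultInstanceW`, NOT this file).  By-name class of every `WALL-NE7b-P1.md` §2 binder UNCHANGED; headline
p224237 UNCHANGED BY NAME; NE7b NOT PRINTED ∕ NOT PROVED; spine 0∕9.  HONEST DEPENDENCY (cell): continuum YM on T⁴ ⇐
BetaPertH ∧ nine spine estimates (0/9 proved); BetaPertH ⇐ (D1) ∧ (D4) ∧ CAP+tail; G-an2-4 gates asym, D1 and NE2/3/4.
This file changes none of it. -/

open Finset MeasureTheory
open Literature.MathematicalPhysics.QuantumFieldTheory.Balaban1983to89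
open T4PersistenceDictionary T4PersistentHistoryCount T4BankedInduction T4PrintedShapeBanking
open T4WeightBudget T4GlobalDenominator T4LiveClassFibration T4LiveStructureGas T4LiveGasToTerms T4RecordPriceSeam
open T4PartnerMultiplicity T4IndicatorShell T4MatchingAssembly T4MatchingClosure T4MatchingClosureSocket T4Continuum
open T4StabilitySocket T4BranchingRecordsGas T4TaggedShapeBanking T4CanonicalMenus T4RenewalChains
open Summit.QuantumFields.BalabanUV.T4Continuum.PlacementBatch
open Summit.QuantumFields.BalabanUV.T4Continuum.PlacementSkeleton
open Summit.QuantumFields.BalabanUV.T4Continuum.CountThresholdUniform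
open Summit.QuantumFields.BalabanUV.T4Continuum.CountThresholdExit
open Summit.QuantumFields.BalabanUV.T4Continuum.CountSeamJunction
open Summit.QuantumFields.BalabanUV.T4Continuum.LateMergers
open Summit.QuantumFields.BalabanUV.T4Continuum.HistoryFlow
open Summit.QuantumFields.BalabanUV.T4Continuum.HistoryRegeneration
open Summit.QuantumFields.BalabanUV.T4Continuum.HistoryTables
open Summit.QuantumFields.BalabanUV.T4Continuum.HistoryAssemblyTrees
open Summit.QuantumFields.BalabanUV.T4Continuum.HistoryAssemblyTerms
open Summit.QuantumFields.BalabanUV.T4Continuum.HistoryAssemblyPedigree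
open Summit.QuantumFields.BalabanUV.T4Continuum.HistoryConstants
open Summit.QuantumFields.BalabanUV.T4Continuum.HistoryGen
open Literature.MathematicalPhysics.QuantumFieldTheory.Balaban1983to89.B13ScaleTransfer
open Summit.QuantumFields.BalabanUV.T4Continuum.ZoneSkeleton
open Summit.QuantumFields.BalabanUV.T4Continuum.HistorySocketTH
open Summit.QuantumFields.BalabanUV.T4Continuum.HistoryCaps
open Summit.QuantumFields.BalabanUV.T4Continuum.HistoryAssemblyPrice
open Summit.QuantumFields.BalabanUV.T4Continuum.HistoryBankingLE
open Summit.QuantumFields.BalabanUV.T4Continuum.HistoryExitLE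
open Summit.QuantumFields.BalabanUV.T4Continuum.HistoryAssemblyTreesLE
open Summit.QuantumFields.BalabanUV.T4Continuum.HistoryAssemblyTermsLE
open Summit.QuantumFields.BalabanUV.T4Continuum.HistoryRealise
open Summit.QuantumFields.BalabanUV.T4Continuum.HistoryAssemblyRealiseLE
open Summit.QuantumFields.BalabanUV.T4Continuum.HistoryAssemblyMult
open Summit.QuantumFields.BalabanUV.T4Continuum.HistoryAssemblyMultKey
open Summit.QuantumFields.BalabanUV.T4Continuum.HistoryAssemblyRealiseRun
open Summit.QuantumFields.BalabanUV.T4Continuum.HistoryAssemblyRealiseMult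
open Summit.QuantumFields.BalabanUV.T4Continuum.HistoryZones
open Summit.QuantumFields.BalabanUV.T4Continuum.HistoryRealiseCells
open Summit.QuantumFields.BalabanUV.T4Continuum.HistoryRealiseCellsRun
open Summit.QuantumFields.BalabanUV.T4Continuum.HistoryAssemblyRealiseRunMult
open Summit.QuantumFields.BalabanUV.T4Continuum.HistoryRealiseWeak
open Summit.QuantumFields.BalabanUV.T4Continuum.HistoryRealiseWeakReading
open Summit.QuantumFields.BalabanUV.T4Continuum.HistoryRealiseWeakCells
open Summit.QuantumFields.BalabanUV.T4Continuum.HistoryAssemblyRealiseRunMultW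
open Summit.QuantumFields.BalabanUV.T4Continuum.HistoryRealiseCellsRunMult

namespace Summit.QuantumFields.BalabanUV.T4Continuum.HistoryRealiseCellsRunMultW

noncomputable section

section End

variable {F : T4Family} {G : Type*} [GaugeGroup G] [MeasurableSpace G] [HaarData G] [RegularGaugeGroup G]
variable {α π δ : Type*} [DecidableEq α] [DecidableEq π] [DecidableEq δ]
variable {ι : Type*} [DecidableEq ι] {l₀ vol : ℝ} {K₀ : ℕ} {T : ℕ → Finset ι} {A A' shA shB : ℕ → ℝ → ι → ℝ}
  {dead dead' : ℕ → ℝ → ι → ℝ} {nup mup : ℕ → ℝ → ℝ} {Nup : ℝ}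
  {Cc Rr CcRec RrRec : ℕ → ℝ → ι → ℝ} {ν u s₂ q₀ r s Wsh : ℕ → ℝ}

/-- **MEMORY-AGNOSTIC TWIN (S12-W)** of `HistoryRealiseCellsRunMult.hybridNE7_of_realisedDomainsRun_printedMult`:
the SAME statement with `RealisedDomainsR ↦ RealisedDomainsRW` (IR-41-4 file 3) in the hypothesis; suppliers `hybridNE7_of_realisedRunW_printedMult` (S12-W W4) and
`realisedReadingRW_of_domainsRunW`; conclusion VERBATIM.  The landed
docstring follows.  **NE7b's COUNT EXIT — THE END OF RECORD v2's TWIN WITH THE SLOT MULTIPLICITY DISPLAYED** (histories read as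
realised DOMAINS of each tuned run's own S-profile, root cells DEFINED by `cellOfR`, printed prices; the S6g′-instance
socket on `HistoryRealiseCellsRunEnd.hybridNE7_of_realisedDomainsRun_printed`, R-OWNER-22-25 (2)).
= `HistoryAssemblyRealiseRunMult.hybridNE7_of_realisedRun_printedMult` at `(cellOfR n F.L (runProfile F.L R) ped cellP) := cellOfR n F.L (runProfile F.L R) ped cellP`
with the reading SUPPLIED by leaf-08 g2's bridge `HistoryRealiseCellsRun.realisedReadingR_of_domainsRun` from
`H : RealisedDomainsR F.L (runProfile F.L R) n K₀ R T ped cellP liveC Zd` + `0 < n`; the occupant key carries the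
ABSTRACT physical reading `phys` (`HistoryAssemblyMultKey`); binder diff against leaf-06 g2's
`HistoryRealiseCellsRunSlack.hybridNE7_of_realisedDomainsRun_printedSlack` (p217406) = only-in-Mult {`phys`, `Λm Λr` +
`hΛm hΛr hΛmr`, `Ξ`, `hmult`, `FcM RfM FcM′ RfM′`-keyed `hPM hPM′ upM deadM_nonneg resumM FM_nonneg` + primed} ∕
only-in-Slack {`Fc Rf Fc′ Rf′`-keyed `hP hP′ up dead_nonneg resum F_nonneg` + primed}; conclusion IDENTICAL to the END
of record v2's. [folklore] -/
theorem hybridNE7_of_realisedDomainsRunW_printedMult (D : FiniteEpsData F G) {C : T4PrintedShapeBanking.Consts}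
    {O : PrintedO1s}
    {rr : ℕ} {β₀ : ℝ} (h : ThresholdOK C F.L rr β₀) (hμ : 0 < C.μ) (d n : ℕ)
    (hκ₁ : (d : ℝ) * Real.log F.L + 2 * Real.log 2 ≤ C.κ₁) (hE₀ : Real.log (2 + birthMass C) ≤ C.E₀)
    -- the profile floor `p₀(g) ≥ 1` along the runs comes from `1 ≤ A₀` and the flow's `log g⁻² ≥ 1`
    (hA₀ : 1 ≤ C.A₀)
    -- the flow side (⇐ BetaPertH, displayed) and tuning
    {γ₀ γb b β' : ℝ} {pe : ℕ} (hb : 0 ≤ b) (hlo : FlowStep.BetaLowerH b γ₀ D.βfun)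
    (hhi : FlowStep.BetaUpperH β' γ₀ D.βfun) (hγ : γb ≤ γ₀) (hγβ : γb ^ 2 * β' < 1)
    (S : B14FlowStep.SmallnessFor γb β' β₀ F.L pe) (hp₀ : C.p₀ ≤ pe) (hrr : rr ≤ pe) (hβ : β₀ ≤ 1 / 2)
    {g : ℝ} {g₀ : ℕ → ℝ} (ht : D.Tuned γb g g₀)
    (hir : irThresholdTLE C F.L rr β₀ ≤ Real.log (g ^ 2)⁻¹)
    -- the (B) side
    (hsign : B16.SignConventions D.C) {γB : ℝ} {em ep : ℝ → ℝ} (hcor : B16.Cor3With D.C γB em ep) (hγB : γb ≤ γB)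
    {obs : (K : ℕ) → GaugeField (F.P K) 0 G → ℝ} {B : ℝ}
    (hobs : ∀ K, Measurable (obs K)) (hbd : ∀ K U, |obs K U| ≤ B)
    (hα : ∀ K t, |t| ≤ l₀ → K₀ ≤ K →
      ∫ U, Real.exp (t * obs K U) * D.dens K (g₀ K) 0 U ∂fieldMeasure (F.P K) 0 G ≤ ∑ τ ∈ T K, A K t τ)
    (hα' : ∀ K t, |t| ≤ l₀ → K₀ ≤ K →
      ∫ U, Real.exp (t * obs (K + 1) U) * D.dens (K + 1) (g₀ (K + 1)) 0 U ∂fieldMeasure (F.P (K + 1)) 0 G ≤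
        ∑ τ ∈ T K, A' K t τ)
    {c₀ n₁ : ℝ} (hc₀ : 0 < c₀) (hfloor : ∀ K, K₀ ≤ K → c₀ ≤ smallFieldMass D K (g₀ K))
    (hfloor' : ∀ K, K₀ ≤ K → c₀ ≤ smallFieldMass D (K + 1) (g₀ (K + 1)))
    (hsites : ∀ K, K₀ ≤ K → ((D.C ⟨K, F.m, g₀ K⟩).numSites K : ℝ) ≤ n₁)
    (hsites' : ∀ K, K₀ ≤ K → ((D.C ⟨K + 1, F.m, g₀ (K + 1)⟩).numSites (K + 1) : ℝ) ≤ n₁)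
    (hNup : 0 ≤ Nup) (hnup : ∀ K t, |t| ≤ l₀ → K₀ ≤ K → 0 ≤ nup K t ∧ nup K t ≤ Nup)
    (hmup : ∀ K t, |t| ≤ l₀ → K₀ ≤ K → 0 ≤ mup K t ∧ mup K t ≤ Nup)
    -- the (2.5) side condition on the size function
    (R : ℕ → ℕ → ℕ) (hR : ∀ K s, s ≤ K → B14.IsRj F.L rr ((D.C ⟨K, F.m, g₀ K⟩).flow.g s) (R K s))
    -- the side conditions of the geometric lemmas (row S1b): torus side, window constant, sizes (NO drop control)
    (hL4 : 4 ≤ F.L) (hn₁ : 13 ≤ C.n₁) (hR1 : ∀ K, K₀ ≤ K → ∀ t, 1 ≤ R K t)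
    -- H3: the terms read as pedigrees REALISED BY THE RUN'S OWN PROFILE with their DOMAINS (root cells := `cellOfR`)
    (ped : ℕ → ι → Pedigree α π) (cellP : ℕ → ι → π → Pt d × Finset (Pt d)) (liveC : ℕ → ι → Finset α)
    (Zd : ℕ → ι → α → Finset (Pt d)) (H : RealisedDomainsRW F.L (runProfile F.L R) n K₀ R T ped cellP liveC Zd)
    (hn : 0 < n)
    -- the PHYSICAL READING of the live components (the consumer's datum: which components of different terms are the same)
    (phys : ℕ → ι → α → δ)
    -- the class-linear slack: `C.a + θ ≤ ½γ₀A₁²` pays the factor `e^{θ·birthLinT}` of the slot multiplicity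
    {θ : ℝ} (hθ : 0 ≤ θ) (hslack : C.a + θ ≤ O.γ₀ * O.A₁ ^ 2 / 2)
    -- the partner letters: `Λm` for the slot multiplicity, `Λr` left in H3's printed price, `Λm·Λr ≤ L^d`
    {Λm Λr : ℝ} (hΛm : 0 ≤ Λm) (hΛr : 0 ≤ Λr) (hΛmr : Λm * Λr ≤ (F.L : ℝ) ^ d)
    -- H3: realised per-step costs of the live members, read below the model's booked cost (reading (ID-a))
    (κ κ' : ℕ → (Fin d → ℕ) × Gen (Lab α π) → Gen (Lab α π) → ℕ → ℝ)
    (hκ : ∀ K, K₀ ≤ K → ∀ τ ∈ badTerms (memOf ped liveC (cellOfR n F.L (runProfile F.L R) ped cellP)) jhalf T K, ∀ q ∈ memOf ped liveC (cellOfR n F.L (runProfile F.L R) ped cellP) K τ,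
      ∀ m ∈ life (padW (dictWT Prod.fst (R K) C.n₁) 0) q.2,
        κ K q q.2 m ≤ costT Prod.fst C K (R K) q.2 m)
    (hκ' : ∀ K, K₀ ≤ K → ∀ τ ∈ badTerms (memOf ped liveC (cellOfR n F.L (runProfile F.L R) ped cellP)) jhalf T K, ∀ q ∈ memOf ped liveC (cellOfR n F.L (runProfile F.L R) ped cellP) K τ,
      ∀ m ∈ life (padW (dictWT Prod.fst (R K) C.n₁) 0) q.2,
        κ' K q q.2 m ≤ costT Prod.fst C K (R K) q.2 m)
    -- row S6g′'s INSTANCE: the renewal-entropy allowance `Ξ` and THE SLOT MULTIPLICITY OF THE PHYSICAL MEMBERS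
    (Ξ : ℕ → (Fin d → ℕ) × Gen (Lab α π) → ℝ)
    (hmult : ∀ K, K₀ ≤ K → ∀ τ ∈ badTerms (memOf ped liveC (cellOfR n F.L (runProfile F.L R) ped cellP)) jhalf T K, ∀ c ∈ liveC K τ,
      ((koccOf ped liveC (cellOfR n F.L (runProfile F.L R) ped cellP) phys jhalf T K (kslot (keyOf ped (cellOfR n F.L (runProfile F.L R) ped cellP) phys K τ c))).card : ℝ) ≤
        Real.exp (θ * birthLinT Prod.fst ((ped K τ).genT c) + Ξ K ((cellOfR n F.L (runProfile F.L R) ped cellP) K τ c, (ped K τ).genT c)) *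
          Λm ^ partnerAges (PEv.step ∘ Prod.fst) ((ped K τ).genT c))
    -- H3: the per-term price sentence over the named members in PRINT's currency, discounted by the allowance; the
    -- live price of the PHYSICAL member family; both runs
    {FcM RfM FcM' RfM' : ℕ → Finset ((Fin d → ℕ) × Gen PEv × δ) → ℝ}
    (hPM : ∀ K t, |t| ≤ l₀ → K₀ ≤ K → ∀ τ ∈ badTerms (memOf ped liveC (cellOfR n F.L (runProfile F.L R) ped cellP)) jhalf T K,
      FcM K (kmemOf ped liveC (cellOfR n F.L (runProfile F.L R) ped cellP) phys K τ) * RfM K (kmemOf ped liveC (cellOfR n F.L (runProfile F.L R) ped cellP) phys K τ) ≤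
        ∏ q ∈ memOf ped liveC (cellOfR n F.L (runProfile F.L R) ped cellP) K τ,
          pshapeTH Prod.fst O C 1 Λr (R K) (D.C ⟨K, F.m, g₀ K⟩).flow.g 0 (κ K q) q.2 * Real.exp (-Ξ K q))
    (hPM' : ∀ K t, |t| ≤ l₀ → K₀ ≤ K → ∀ τ ∈ badTerms (memOf ped liveC (cellOfR n F.L (runProfile F.L R) ped cellP)) jhalf T K,
      FcM' K (kmemOf ped liveC (cellOfR n F.L (runProfile F.L R) ped cellP) phys K τ) * RfM' K (kmemOf ped liveC (cellOfR n F.L (runProfile F.L R) ped cellP) phys K τ) ≤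
        ∏ q ∈ memOf ped liveC (cellOfR n F.L (runProfile F.L R) ped cellP) K τ,
          pshapeTH Prod.fst O C 1 Λr (R K) (D.C ⟨K, F.m, g₀ K⟩).flow.g 0 (κ' K q) q.2 * Real.exp (-Ξ K q))
    -- H3: the remaining `Regeneration` numerator readings, over the PHYSICAL member families of the bad terms
    (upM : ∀ K t, |t| ≤ l₀ → K₀ ≤ K →
      ∀ k ∈ badGMems (memOf ped liveC (cellOfR n F.L (runProfile F.L R) ped cellP)) jhalf T (kmemOf ped liveC (cellOfR n F.L (runProfile F.L R) ped cellP) phys) K,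
        ∀ τ ∈ fibre (kmemOf ped liveC (cellOfR n F.L (runProfile F.L R) ped cellP) phys) T K k, A K t τ ≤ dead K t τ * FcM K k * nup K t)
    (deadM_nonneg : ∀ K t, |t| ≤ l₀ → K₀ ≤ K →
      ∀ k ∈ badGMems (memOf ped liveC (cellOfR n F.L (runProfile F.L R) ped cellP)) jhalf T (kmemOf ped liveC (cellOfR n F.L (runProfile F.L R) ped cellP) phys) K,
        ∀ τ ∈ fibre (kmemOf ped liveC (cellOfR n F.L (runProfile F.L R) ped cellP) phys) T K k, 0 ≤ dead K t τ)
    (resumM : ∀ K t, |t| ≤ l₀ → K₀ ≤ K →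
      ∀ k ∈ badGMems (memOf ped liveC (cellOfR n F.L (runProfile F.L R) ped cellP)) jhalf T (kmemOf ped liveC (cellOfR n F.L (runProfile F.L R) ped cellP) phys) K,
        ∑ τ ∈ fibre (kmemOf ped liveC (cellOfR n F.L (runProfile F.L R) ped cellP) phys) T K k, dead K t τ ≤ RfM K k)
    (FM_nonneg : ∀ K t, |t| ≤ l₀ → K₀ ≤ K →
      ∀ k ∈ badGMems (memOf ped liveC (cellOfR n F.L (runProfile F.L R) ped cellP)) jhalf T (kmemOf ped liveC (cellOfR n F.L (runProfile F.L R) ped cellP) phys) K, 0 ≤ FcM K k)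
    (upM' : ∀ K t, |t| ≤ l₀ → K₀ ≤ K →
      ∀ k ∈ badGMems (memOf ped liveC (cellOfR n F.L (runProfile F.L R) ped cellP)) jhalf T (kmemOf ped liveC (cellOfR n F.L (runProfile F.L R) ped cellP) phys) K,
        ∀ τ ∈ fibre (kmemOf ped liveC (cellOfR n F.L (runProfile F.L R) ped cellP) phys) T K k, A' K t τ ≤ dead' K t τ * FcM' K k * mup K t)
    (deadM'_nonneg : ∀ K t, |t| ≤ l₀ → K₀ ≤ K →
      ∀ k ∈ badGMems (memOf ped liveC (cellOfR n F.L (runProfile F.L R) ped cellP)) jhalf T (kmemOf ped liveC (cellOfR n F.L (runProfile F.L R) ped cellP) phys) K,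
        ∀ τ ∈ fibre (kmemOf ped liveC (cellOfR n F.L (runProfile F.L R) ped cellP) phys) T K k, 0 ≤ dead' K t τ)
    (resumM' : ∀ K t, |t| ≤ l₀ → K₀ ≤ K →
      ∀ k ∈ badGMems (memOf ped liveC (cellOfR n F.L (runProfile F.L R) ped cellP)) jhalf T (kmemOf ped liveC (cellOfR n F.L (runProfile F.L R) ped cellP) phys) K,
        ∑ τ ∈ fibre (kmemOf ped liveC (cellOfR n F.L (runProfile F.L R) ped cellP) phys) T K k, dead' K t τ ≤ RfM' K k)
    (FM'_nonneg : ∀ K t, |t| ≤ l₀ → K₀ ≤ K →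
      ∀ k ∈ badGMems (memOf ped liveC (cellOfR n F.L (runProfile F.L R) ped cellP)) jhalf T (kmemOf ped liveC (cellOfR n F.L (runProfile F.L R) ped cellP) phys) K, 0 ≤ FcM' K k)
    -- the seam's other inputs
    (hSh : ShellWeightBound l₀ T A A' shA shB Wsh)
    (hTB : ReindexedBudget l₀ vol T (fun K t τ => A K t τ - shA K t τ) (fun K t τ => A' K t τ - shB K t τ)
      (badOfClass (bstrOf Prod.fst (memOf ped liveC (cellOfR n F.L (runProfile F.L R) ped cellP))) T
        (fun K _ => badClasses Prod.fst (memOf ped liveC (cellOfR n F.L (runProfile F.L R) ped cellP)) jhalf T K)) Cc Rr CcRec RrRec ν u s₂ q₀ r s)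
    (hr : Summable r) (hu : Summable u) (hs : Summable s) (hs₂ : Summable s₂) :
    ∃ K₁ K₂, K₀ ≤ K₁ ∧ HybridNE7 l₀ vol (fun K => T (K₁ + (K₂ + K))) (fun K => A (K₁ + (K₂ + K)))
      (fun K => A' (K₁ + (K₂ + K)))
      (fun K => badOfClass (bstrOf Prod.fst (memOf ped liveC (cellOfR n F.L (runProfile F.L R) ped cellP))) T
        (fun K _ => badClasses Prod.fst (memOf ped liveC (cellOfR n F.L (runProfile F.L R) ped cellP)) jhalf T K) (K₁ + (K₂ + K)))
      (fun K => constOf l₀ B (max (em g) 0) n₁ c₀ Nup *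
        recordsBudget (birthMass C) C.κ₁ ((n : ℝ) ^ d) ((F.L : ℝ) ^ d) (Real.log 2) jhalf (K₁ + (K₂ + K)))
      (fun K => shA (K₁ + (K₂ + K))) (fun K => shB (K₁ + (K₂ + K))) (fun K => Wsh (K₁ + (K₂ + K)))
      (fun K => (r (K₁ + (K₂ + K)) + u (K₁ + (K₂ + K))) + (s (K₁ + (K₂ + K)) + s₂ (K₁ + (K₂ + K)))) :=
  hybridNE7_of_realisedRunW_printedMult D h hμ d n hκ₁ hE₀ hA₀ hb hlo hhi hγ hγβ S hp₀ hrr hβ ht hir hsign hcor hγB hobs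
    hbd hα hα' hc₀ hfloor hfloor' hsites hsites' hNup hnup hmup R hR hL4 hn₁ hR1 ped cellP liveC
    (cellOfR n F.L (runProfile F.L R) ped cellP)
    (realisedReadingRW_of_domainsRunW D hb hlo hhi hγ hγβ S hrr hβ ht R hR hn H) phys hθ hslack hΛm hΛr hΛmr κ κ' hκ hκ'
    Ξ hmult hPM hPM' upM deadM_nonneg resumM FM_nonneg upM' deadM'_nonneg resumM' FM'_nonneg hSh hTB hr hu hs hs₂

end End

end

end Summit.QuantumFields.BalabanUV.T4Continuum.HistoryRealiseCellsRunMultW
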